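import Mathlib
import HarnessLib.Audit
import Summits.PneNP.PneNP.Theorems.PstarDirtyAssembly
import Summits.PneNP.PneNP.Theorems.PstarCentreGateBudgetParts

/-!
# The census node under the gate budget (ROUND-24, O1; memo g25 §53–54)

FRONTIER range-avoidance ladder, rung F-N3, ROUND 24 (cell `pnp-ideate`, prover-2 memo `g25/O1-XORSPLIT-g25.md` §50–54; typed targets
`PstarCoreBoundTargets.TerminalFive` / `TerminalPeelable` (p646951); restricted-model proof complexity — nothing here bears on `P` versus `NP`).

Inside the core-bound induction every terminal core with a centre obeys the GATE BUDGET over its parts (`PstarCentreGateBudgetParts.centre_gate_budget_parts`):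
for every partition `parts` of the core into separated X-connected parts, every centre `S`, every set `H` of inside gates, every `D ⊇` dirty chords
and every doubly shared `N₀`, `2·#bdry + 3·#H + #S + 2·#N₀ ≤ 2·#bdry (J₀ ∪ H) + 2·#D + 2·#{P ∈ parts : P ∩ S = ∅}`; an X-connected core moreover
has slack `≥ 3` and two dirty chords (`PstarDirtyAssembly`).  The census node shrinks accordingly: **`MenuCriterionBoundGateBudget`** =
`MenuCriterionBound` restricted to the terminal cores with a centre satisfying `GateBudget` (and, when X-connected, the explicit slack / dirty-chord
corollaries); `terminalFive_of_menuBoundGateBudget : TerminalFiveA → node → TerminalFive`, `terminalPeelable_of_menuBoundGateBudget`, and the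
comparison `menuCriterionBoundGateBudget_of_twoDirty`.
-/

set_option linter.dupNamespace false -- `Summit.PneNP.PneNP.…`: summit = sub-problem name (D-0017 single-conjunct layout)

open Finset Literature.Computability.Complexity
open Summit.PneNP.PneNP.Theorems.PstarTyped (Typed)
open Summit.PneNP.PneNP.Theorems.PstarSALevel (varSet bdry BoundaryExpanding SimpleOverlap)
open Summit.PneNP.PneNP.Theorems.PstarXCore (xverts)
open Summit.PneNP.PneNP.Theorems.PstarCoreBound (XorClosed)
open Summit.PneNP.PneNP.Theorems.PstarChordRepair (IsChord)
open Summit.PneNP.PneNP.Theorems.PstarCoreBoundTargets (Terminal TerminalFive TerminalFiveA TerminalPeelable nonchords nonchords_subset mem_nonchords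
  terminalPeelable_of_terminalFive)
open Summit.PneNP.PneNP.Theorems.PstarSharingBound (sharedSlots)
open Summit.PneNP.PneNP.Theorems.PstarChordBridgeTools (xpdeg)
open Summit.PneNP.PneNP.Theorems.PstarChordBridgeCentre (exists_maximal_peelable_sup)
open Summit.PneNP.PneNP.Theorems.PstarChordReadOutside (OutsideGated)
open Summit.PneNP.PneNP.Theorems.PstarSliceGenericCriterion (NoShortCoincidence)
open Summit.PneNP.PneNP.Theorems.PstarCleanChordCount (exists_clean_chords)
open Summit.PneNP.PneNP.Theorems.PstarTerminalPeelableTwelve (exists_centre_of_not_peelable)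
open Summit.PneNP.PneNP.Theorems.PstarNoFreeVertex (Covered covered_of_terminal)
open Summit.PneNP.PneNP.Theorems.PstarHangingForest (Anchored anchored_of_terminal)
open Summit.PneNP.PneNP.Theorems.PstarCleanCut (smallCriterion_of_crossing)
open Summit.PneNP.PneNP.Theorems.PstarCleanCutAssembly (false_of_cleanCut_two SkConnected NoTwoCrossings)
open Summit.PneNP.PneNP.Theorems.PstarTwoCleanExact (MenuGeneric false_of_two_clean_exact)
open Summit.PneNP.PneNP.Theorems.PstarMenuCriterion (NoSmallPathSumSubcoreExact channelMenus subset_of_mem_channelMenus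
  noSmallPathSumSubcoreExact_of_subset noShortCoincidence_anti menuGeneric_of_criterion)
open Summit.PneNP.PneNP.Theorems.PstarSkeletonSpan (XConnected)
open Summit.PneNP.PneNP.Theorems.PstarSlackOneCentre (no_centre_at_slack_one)
open Summit.PneNP.PneNP.Theorems.PstarSlackAssembly (no_centre_at_slack_zero)
open Summit.PneNP.PneNP.Theorems.PstarDirtyAssembly (MenuCriterionBoundTwoDirty)
open Summit.PneNP.PneNP.Theorems.PstarSlackTwoClean (no_centre_at_slack_two)
open Summit.PneNP.PneNP.Theorems.PstarCentreTwoDirty (exists_two_dirty_of_centre)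
open Summit.PneNP.PneNP.Theorems.PstarCentreGateBudgetParts (centre_gate_budget_parts)

namespace Summit.PneNP.PneNP.Theorems.PstarCentreGateBudgetAssembly

variable {n m : ℕ}

/-- **GATE BUDGET hypothesis** for a core `J₀` with menu `M`: for every partition `parts` of `J₀` into separated X-connected parts, every centre
`S`, every set `H ⊆ M` of inside gates, every `D` containing the dirty chords and every doubly shared `N₀ ⊆ J₀`:
`2·#bdry J₀ + 3·#H + #S + 2·#N₀ ≤ 2·#bdry (J₀ ∪ H) + 2·#D + 2·#{P ∈ parts : P ∩ S = ∅}`. -/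
def GateBudget (I : LocalMap 4 n m) (J₀ M : Finset (Fin m)) : Prop :=
  ∀ parts : Finset (Finset (Fin m)), (∀ P ∈ parts, P ⊆ J₀) → (∀ f ∈ J₀, ∃ P ∈ parts, f ∈ P) →
    (∀ P ∈ parts, ∀ P' ∈ parts, P ≠ P' → Disjoint P P') →
    (∀ P ∈ parts, ∀ f ∈ J₀, f ∉ P → I.vars f 0 ∉ xverts I P ∧ I.vars f 1 ∉ xverts I P) → (∀ P ∈ parts, XConnected I P) →
  ∀ S ⊆ J₀, S.Nonempty → (∀ w ∈ xverts I S, 2 ≤ xpdeg I S w) → (∀ f ∈ S, ¬ IsChord I J₀ f) →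
    ∀ H ⊆ M, (∀ h ∈ H, (∃ j ∈ J₀, I.vars h 2 ∈ varSet I j) ∧ ∃ j ∈ J₀, I.vars h 3 ∈ varSet I j) →
      ∀ D : Finset (Fin m), (∀ d ∈ J₀, IsChord I J₀ d → ¬ OutsideGated I J₀ M d → d ∈ D) →
        ∀ N₀ ⊆ J₀, (∀ f ∈ N₀, I.vars f 2 ∉ bdry I J₀ ∧ I.vars f 3 ∉ bdry I J₀) →
          2 * (bdry I J₀).card + 3 * H.card + S.card + 2 * N₀.card ≤
            2 * (bdry I (J₀ ∪ H)).card + 2 * D.card + 2 * (parts.filter fun P => P ∩ S = ∅).card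

/-- **`MenuCriterionBoundGateBudget` (OPEN, census-type)**: `MenuCriterionBound` restricted to the terminal cores with a centre that satisfy the
gate budget `GateBudget` over every partition into separated X-connected parts and, when X-connected, have boundary slack at least three and two
distinct dirty chords.  FRONTIER. -/
@[conjecture] def MenuCriterionBoundGateBudget : Prop :=
  ∀ (n m r : ℕ) (I : LocalMap 4 n m), I.IsPure xorAndPred → Typed I → SimpleOverlap I → BoundaryExpanding r I →
    ∀ (y : Fin m → Bool) (J₀ : Finset (Fin m)) (w₁ w₂ : Finset (Fin n) × Finset (Fin m) × Bool), Terminal I r y J₀ w₁ w₂ →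
      (∃ S ⊆ J₀, S.Nonempty ∧ (∀ w ∈ xverts I S, 2 ≤ xpdeg I S w) ∧ ∀ f ∈ S, ¬ IsChord I J₀ f) →
      Covered I J₀ (w₁.2.1 ∪ w₂.2.1) → Anchored I J₀ (w₁.2.1 ∪ w₂.2.1) → NoTwoCrossings I J₀ (w₁.2.1 ∪ w₂.2.1) →
      GateBudget I J₀ (w₁.2.1 ∪ w₂.2.1) →
      (XConnected I J₀ → 3 * J₀.card + 3 ≤ 2 * (bdry I J₀).card ∧
        ∃ d₁ ∈ J₀, ∃ d₂ ∈ J₀, d₁ ≠ d₂ ∧ IsChord I J₀ d₁ ∧ ¬ OutsideGated I J₀ (w₁.2.1 ∪ w₂.2.1) d₁ ∧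
          IsChord I J₀ d₂ ∧ ¬ OutsideGated I J₀ (w₁.2.1 ∪ w₂.2.1) d₂) →
      ∃ ℬ ⊆ J₀, ℬ.card + 2 ≤ (sharedSlots I J₀).card ∧
        ∀ c ∈ J₀, c ∉ ℬ → IsChord I J₀ c → OutsideGated I J₀ (w₁.2.1 ∪ w₂.2.1) c → SkConnected I J₀ (w₁.2.1 ∪ w₂.2.1) c →
          ∀ G ∈ channelMenus I J₀ w₁ w₂, NoSmallPathSumSubcoreExact I r y J₀ c G ∧ NoShortCoincidence I J₀ c G

/-- The new node is weaker than `MenuCriterionBoundTwoDirty`. -/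
theorem menuCriterionBoundGateBudget_of_twoDirty (h : MenuCriterionBoundTwoDirty) : MenuCriterionBoundGateBudget := by
  intro n m r I hI hT hS hB y J₀ w₁ w₂ ht hc hcov hanc hN2 _ hx
  exact h n m r I hI hT hS hB y J₀ w₁ w₂ ht hc hcov hanc hN2 hx

/-- **THE CORE BOUND FROM O2 AND THE NODE UNDER THE GATE BUDGET** — the strong induction of `terminalFive_of_menuBound`; the X-connected structures
violating the gate budget (in particular those of slack `≤ 2` or with at most one dirty chord) excluded by name. -/
theorem terminalFive_of_menuBoundGateBudget (hO2 : TerminalFiveA) (hb : MenuCriterionBoundGateBudget) : TerminalFive := by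
  classical
  suffices H : ∀ (k n m r : ℕ) (I : LocalMap 4 n m), I.IsPure xorAndPred → Typed I → SimpleOverlap I → BoundaryExpanding r I →
      ∀ (y : Fin m → Bool) (J₀ : Finset (Fin m)) (w₁ w₂ : Finset (Fin n) × Finset (Fin m) × Bool), Terminal I r y J₀ w₁ w₂ →
        J₀.card = k → J₀.card ≤ 5 from
    fun n m r I hI hT hS hB y J₀ w₁ w₂ ht => H _ n m r I hI hT hS hB y J₀ w₁ w₂ ht rfl
  intro k
  induction k using Nat.strong_induction_on with
  | _ k ih =>
    intro n m r I hI hT hS hB y J₀ w₁ w₂ ht hk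
    by_cases hP : PstarChordBridgeCotree.Peelable I (nonchords I J₀)
    · obtain ⟨F, hS₀F, hFJ, hPF, hmax⟩ := exists_maximal_peelable_sup I (nonchords_subset I J₀) hP
      refine hO2 n m r I hI hT hS hB y J₀ w₁ w₂ ht F hFJ hPF hmax fun e he => ?_
      rw [mem_sdiff] at he
      by_contra hc
      exact he.2 (hS₀F ((mem_nonchords I).2 ⟨he.1, hc⟩))
    · exfalso
      obtain ⟨S, hSJ, hne, hL, hnc⟩ := exists_centre_of_not_peelable I hP
      have hdisj : Disjoint J₀ (w₁.2.1 ∪ w₂.2.1) := disjoint_union_right.2 ⟨ht.2.2.2.1, ht.2.2.2.2.1⟩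
      set 𝒢 := w₁.2.1 ∪ w₂.2.1 with h𝒢
      have hIH : ∀ c ∈ J₀, ∀ K₀ ⊆ J₀.erase c, ∀ d₁ d₂ : Finset (Fin n) × Finset (Fin m) × Bool, Terminal I r y K₀ d₁ d₂ → K₀.card ≤ 5 := by
        intro c hc K₀ hK₀ d₁ d₂ ht₀
        have hlt : K₀.card < k := by
          rw [← hk]
          exact lt_of_le_of_lt (card_le_card hK₀) (card_erase_lt_of_mem hc)
        exact ih K₀.card hlt n m r I hI hT hS hB y K₀ d₁ d₂ ht₀ rfl
      -- the slack layers `0`, `1`, `2` of X-connected cores carry no centre, and a centre forces two dirty chords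
      have hbudget : GateBudget I J₀ (w₁.2.1 ∪ w₂.2.1) :=
        fun parts hpK hpcov hpdisj hpsep hpconn S' hS'J hS'ne hS'L hS'nc H hHM hHin D hD N₀ hN₀J hN₀ =>
          centre_gate_budget_parts hI hT hS hB ht hIH parts hpK hpcov hpdisj hpsep hpconn hS'J hS'ne hS'L hS'nc hHM hHin hD hN₀J hN₀
      have hslack : XConnected I J₀ → 3 * J₀.card + 3 ≤ 2 * (bdry I J₀).card ∧
          ∃ d₁ ∈ J₀, ∃ d₂ ∈ J₀, d₁ ≠ d₂ ∧ IsChord I J₀ d₁ ∧ ¬ OutsideGated I J₀ (w₁.2.1 ∪ w₂.2.1) d₁ ∧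
            IsChord I J₀ d₂ ∧ ¬ OutsideGated I J₀ (w₁.2.1 ∪ w₂.2.1) d₂ := by
        intro hconn
        refine ⟨?_, exists_two_dirty_of_centre hI hT hS hB ht hIH hconn ⟨S, hSJ, hne, hL, hnc⟩⟩
        have hexp : 3 * J₀.card ≤ 2 * (bdry I J₀).card := hB J₀ ht.2.2.1.le
        by_contra h3
        by_cases h0 : 2 * (bdry I J₀).card = 3 * J₀.card
        · exact no_centre_at_slack_zero hI hT hS hB ht hIH hconn h0 ⟨S, hSJ, hne, hL, hnc⟩
        by_cases h1 : 2 * (bdry I J₀).card = 3 * J₀.card + 1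
        · exact no_centre_at_slack_one hI hT hS hB ht hIH hconn h1 ⟨S, hSJ, hne, hL, hnc⟩
        have h2 : 2 * (bdry I J₀).card = 3 * J₀.card + 2 := by omega
        exact no_centre_at_slack_two hI hT hS hB ht hIH hconn h2 ⟨S, hSJ, hne, hL, hnc⟩
      have hN2 : NoTwoCrossings I J₀ 𝒢 := fun W e₁ e₂ he₁ he₂ hne hc₁ hc₂ hcut =>
        false_of_cleanCut_two hI hT hS hB ht hIH hcut he₁ he₂ hne hc₁ hc₂
      obtain ⟨ℬ, -, hℬ, hgood⟩ := hb n m r I hI hT hS hB y J₀ w₁ w₂ ht ⟨S, hSJ, hne, hL, hnc⟩ (covered_of_terminal hI hT hS hB ht)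
        (anchored_of_terminal hI hT hS hB ht) hN2 hbudget hslack
      obtain ⟨𝒞, h𝒞J, hch, hO, hcard⟩ := exists_clean_chords hB ht
      have hU : 1 < (𝒞 \ ℬ).card := by
        have := le_card_sdiff ℬ 𝒞
        omega
      obtain ⟨a, ha, b, hb', hab⟩ := one_lt_card.1 hU
      obtain ⟨ha𝒞, haℬ⟩ := mem_sdiff.1 ha
      obtain ⟨hb𝒞, hbℬ⟩ := mem_sdiff.1 hb'
      have hcrit : ∀ c ∈ 𝒞, c ∉ ℬ → ∀ G ∈ channelMenus I J₀ w₁ w₂,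
          NoSmallPathSumSubcoreExact I r y J₀ c G ∧ NoShortCoincidence I J₀ c G := by
        intro c hc hcℬ G hG
        by_cases hsk : SkConnected I J₀ 𝒢 c
        · exact hgood c (h𝒞J hc) hcℬ (hch c hc) (hO c hc) hsk G hG
        · unfold PstarCleanCutAssembly.SkConnected at hsk
          push Not at hsk
          obtain ⟨W, hcW, hcut⟩ := hsk
          obtain ⟨hA, hBc⟩ := smallCriterion_of_crossing (y := y) (r := r) hI hT hS hB hdisj (fun f hf hcf => hcut f hf hcf) hcW
          exact ⟨noSmallPathSumSubcoreExact_of_subset hA (subset_of_mem_channelMenus hG),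
            noShortCoincidence_anti hBc (subset_of_mem_channelMenus hG)⟩
      have hgen : ∀ c ∈ 𝒞, c ∉ ℬ → MenuGeneric I y J₀ c w₁ w₂ := fun c hc hcℬ =>
        menuGeneric_of_criterion hI hT hS hB ht (h𝒞J hc) (hIH c (h𝒞J hc)) (hcrit c hc hcℬ)
      exact false_of_two_clean_exact hI hT hS hB ht (h𝒞J ha𝒞) (h𝒞J hb𝒞) hab (hch a ha𝒞) (hch b hb𝒞) (hO a ha𝒞) (hO b hb𝒞)
        (hgen a ha𝒞 haℬ) (hgen b hb𝒞 hbℬ)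

/-- **O1 from the same inputs.** -/
theorem terminalPeelable_of_menuBoundGateBudget (hO2 : TerminalFiveA) (hb : MenuCriterionBoundGateBudget) : TerminalPeelable :=
  terminalPeelable_of_terminalFive (terminalFive_of_menuBoundGateBudget hO2 hb)

/-- **Using the gate budget on an X-connected core** (convenience for the census): the partition `{J₀}` has no centre-free part, so
`GateBudget` yields the plain inequality `2·#bdry J₀ + 3·#H + #S + 2·#N₀ ≤ 2·#bdry (J₀ ∪ H) + 2·#D`. -/
theorem gateBudget_xconnected {I : LocalMap 4 n m} {J₀ M : Finset (Fin m)} (hGB : GateBudget I J₀ M) (hconn : XConnected I J₀)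
    {S : Finset (Fin m)} (hSJ : S ⊆ J₀) (hSne : S.Nonempty) (hSL : ∀ w ∈ xverts I S, 2 ≤ xpdeg I S w) (hSnc : ∀ f ∈ S, ¬ IsChord I J₀ f)
    {H : Finset (Fin m)} (hHM : H ⊆ M) (hHin : ∀ h ∈ H, (∃ j ∈ J₀, I.vars h 2 ∈ varSet I j) ∧ ∃ j ∈ J₀, I.vars h 3 ∈ varSet I j)
    {D : Finset (Fin m)} (hD : ∀ d ∈ J₀, IsChord I J₀ d → ¬ OutsideGated I J₀ M d → d ∈ D)
    {N₀ : Finset (Fin m)} (hN₀J : N₀ ⊆ J₀) (hN₀ : ∀ f ∈ N₀, I.vars f 2 ∉ bdry I J₀ ∧ I.vars f 3 ∉ bdry I J₀) :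
    2 * (bdry I J₀).card + 3 * H.card + S.card + 2 * N₀.card ≤ 2 * (bdry I (J₀ ∪ H)).card + 2 * D.card := by
  classical
  have h := hGB {J₀} (fun P hP => by rw [mem_singleton.1 hP]) (fun f hf => ⟨J₀, mem_singleton_self _, hf⟩)
    (fun P hP P' hP' hne => absurd ((mem_singleton.1 hP).trans (mem_singleton.1 hP').symm) hne)
    (fun P hP f hf hfP => absurd hf (by rw [mem_singleton.1 hP] at hfP; exact hfP)) (fun P hP => by rw [mem_singleton.1 hP]; exact hconn)
    S hSJ hSne hSL hSnc H hHM hHin D hD N₀ hN₀J hN₀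
  have h0 : (({J₀} : Finset (Finset (Fin m))).filter fun P => P ∩ S = ∅).card = 0 := by
    refine card_eq_zero.2 (filter_eq_empty_iff.2 fun P hP hPS => ?_)
    rw [mem_singleton.1 hP, inter_eq_right.2 hSJ] at hPS
    exact hSne.ne_empty hPS
  rw [h0] at h
  omega

end Summit.PneNP.PneNP.Theorems.PstarCentreGateBudgetAssembly
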